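import Literature.NumberTheory.LFunctions.HeckeThetaPieces
import HarnessLib

/-!
# The Dirichlet series over the representatives of a sign piece: convergence and holomorphy

Topic `Literature/NumberTheory/LFunctions`; namespace `Literature.NumberTheory.LFunctions.NumberField`
(continuing `HeckeThetaPieces.lean`).  Fifth step of the continuation of the partial zeta functions
of narrow ray classes (Neukirch, *Algebraic Number Theory*, VII §8, Remark 1 after (8.6), carried out
as in §5/§8 for cosets `a₀ + 𝔞` and sign weights): the right-hand side of the unfolded Mellin
transform of a sign piece (`lintegral_Ioi_rpow_mul_lintegral_unitCube_pieceTheta`) is a multiple of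
the **Dirichlet series over the representatives**

  `D(s) = Σ_{x ∈ pieceReps K p ς 𝔞 a₀ N} |N_{K/ℚ}(x)|^{-s}`     (`pieceDirichlet`),

Neukirch's `Σ_{a ∈ ℜ} χ((a)) |N(a)|^{-s}` of VII §8 (p. 496, after (8.1)) for one sign piece.  We PROVE:

* `tsum_pieceReps_norm_rpow_ne_top`: `Σ_{x ∈ pieceReps} |N(x)|^{-σ} < ∞` for real `σ > 1`
  (comparison with the cone points of `𝒪_K`: a common denominator `d ∈ ℕ` maps the coset into
  `𝒪_K` without changing cone exponents, the box condition on the cone exponent makes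
  `x ↦ (cone representative of dx, cone exponent)` injective with finitely many second
  coordinates, and `Σ_{cone points of 𝒪} |N|^{-σ} = w Σ_{(a) principal} 𝔑(a)^{-σ} < ∞`,
  `tsum_conePoints_norm_rpow_eq` of `DedekindZetaMellinProofs.lean`, Neukirch VII (5.2)–(5.4));
* `summable_norm_pieceDirichlet_term`, `differentiableOn_pieceDirichlet`: absolute convergence and
  holomorphy of `D(s)` on `re s > 1` (Neukirch VII (8.1) for the partial series);
* `pieceDirichlet_ofReal`: at real `s > 1`, `D(s)` is the `ℝ≥0∞`-valued series of the unfolding.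

## References

* J. Neukirch, *Algebraic Number Theory*, Grundlehren 322, Springer 1999, Ch. VII §5 (5.2)–(5.4),
  §8 (8.1) and the proof of (8.3), Remark 1 after (8.6). [NeukirchANT1999]
-/

noncomputable section

open MeasureTheory Filter Set Submodule Complex NumberField NumberField.InfinitePlace
  NumberField.mixedEmbedding NumberField.Units
open scoped Real Topology ENNReal NumberField nonZeroDivisors

namespace Literature.NumberTheory.LFunctions

namespace NumberField

variable {K : Type*} [Field K] [NumberField K]

open scoped Classical

open NumberField.mixedEmbedding NumberField.mixedEmbedding.fundamentalCone
  NumberField.Units.dirichletUnitTheorem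

/-! ## Integral multiples, units and the cone exponent -/

omit [NumberField K] in
/-- `j(d x) = d • j(x)` for a natural number `d` (the mixed embedding is a ring homomorphism and
`j(d)` is the diagonal `d`). [folklore] -/
theorem mixedEmbedding_natCast_mul (d : ℕ) (x : K) :
    mixedEmbedding K ((d : K) * x) = (d : ℝ) • mixedEmbedding K x := by
  rw [map_mul, map_natCast]
  refine Prod.ext (funext fun w ↦ ?_) (funext fun w ↦ ?_)
  · simp [Prod.fst_mul, Prod.smul_fst]
  · simp [Prod.snd_mul, Prod.smul_snd, Complex.real_smul]

/-- **Multiplying by a natural number `d ≠ 0` does not change the cone exponent**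
(`j(u_m d x) = d • j(u_m x)` and the fundamental cone is stable under real scalars, Mathlib
`fundamentalCone.smul_mem_of_mem`). [folklore] -/
theorem coneExp_natCast_mul {d : ℕ} (hd : d ≠ 0) (x : K) : coneExp ((d : K) * x) = coneExp x := by
  by_cases hx : x = 0
  · rw [hx, mul_zero]
  have hdx : (d : K) * x ≠ 0 := mul_ne_zero (Nat.cast_ne_zero.mpr hd) hx
  rw [coneExp_of_ne_zero hdx, coneExp_of_ne_zero hx]
  refine coneExponent_eq hdx ?_
  rw [mul_left_comm, mixedEmbedding_natCast_mul]
  exact smul_mem_of_mem (coneExponent_spec x hx) (Nat.cast_ne_zero.mpr hd)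

/-- `|N(u x)| = |N(x)|` for a unit `u` (`|N(u)| = 1`, Mathlib `NumberField.Units.norm`). [folklore] -/
theorem abs_norm_unit_mul (u : (𝓞 K)ˣ) (x : K) :
    |Algebra.norm ℚ ((u : K) * x)| = |Algebra.norm ℚ x| := by
  rw [map_mul, abs_mul, NumberField.Units.norm, one_mul]

/-- `|N(d x)| = d^n |N(x)|` for a natural number `d` (Mathlib `Algebra.norm_algebraMap`). [folklore] -/
theorem abs_norm_natCast_mul (d : ℕ) (x : K) :
    |Algebra.norm ℚ ((d : K) * x)| = (d : ℚ) ^ Module.finrank ℚ K * |Algebra.norm ℚ x| := by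
  rw [map_mul, abs_mul, show ((d : K)) = algebraMap ℚ K (d : ℚ) by simp, Algebra.norm_algebraMap,
    abs_pow, Nat.abs_cast]

/-- **A common natural denominator**: for a fractional ideal `J` there is `d ∈ ℕ`, `d ≠ 0`, with
`d J ⊆ 𝒪_K` (`J` is fractional with some denominator `a ∈ 𝒪_K ∖ 0`, and `𝔑((a)) ∈ (a)`, Mathlib
`Ideal.absNorm_mem`). [folklore] -/
theorem exists_natCast_mul_mem_one (J : FractionalIdeal (𝓞 K)⁰ K) :
    ∃ d : ℕ, d ≠ 0 ∧ ∀ x ∈ J, (d : K) * x ∈ (1 : FractionalIdeal (𝓞 K)⁰ K) := by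
  obtain ⟨a, ha, hJ⟩ := J.isFractional
  have ha0 : (a : 𝓞 K) ≠ 0 := nonZeroDivisors.ne_zero ha
  set d : ℕ := Ideal.absNorm (Ideal.span {a}) with hd
  have hd0 : d ≠ 0 := by
    rw [hd, ne_eq, Ideal.absNorm_eq_zero_iff, Ideal.span_singleton_eq_bot]
    exact ha0
  obtain ⟨t, ht⟩ : ∃ t : 𝓞 K, t * a = d := Ideal.mem_span_singleton'.mp (Ideal.absNorm_mem _)
  refine ⟨d, hd0, fun x hx ↦ ?_⟩
  obtain ⟨y, hy⟩ : ∃ y : 𝓞 K, algebraMap (𝓞 K) K y = a • x := by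
    have h := hJ x hx
    exact h
  refine (FractionalIdeal.mem_one_iff (𝓞 K)⁰).mpr ⟨t * y, ?_⟩
  rw [map_mul, hy, Algebra.smul_def, ← mul_assoc, ← map_mul, ht]
  simp

/-! ## Convergence of the norm series over the representatives -/

omit [NumberField K] in
/-- The nonzero integral ideal `𝒪_K = 1` as a fractional ideal. [folklore] -/
theorem coeIdeal_one_eq : ((((1 : (Ideal (𝓞 K))⁰) : Ideal (𝓞 K)) : FractionalIdeal (𝓞 K)⁰ K)) = 1 := by
  rw [OneMemClass.coe_one, Ideal.one_eq_top, FractionalIdeal.coeIdeal_top]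

/-- **The norm series over the cone points of `𝒪_K` converges for `σ > 1`**:
`Σ_{a ∈ cone pts of 𝒪} |N(a)|^{-σ} = w · Σ_{(a) principal} 𝔑((a))^{-σ} < ∞` (Neukirch VII (5.2)–(5.4);
`tsum_conePoints_norm_rpow_eq` and `summable_norm_classSum_term`). [cite: NeukirchANT1999, Ch. VII §5 (5.2)–(5.4)] -/
theorem tsum_conePoints_one_norm_rpow_ne_top {σ : ℝ} (hσ : 1 < σ) :
    ∑' a : conePoints K ((((1 : (Ideal (𝓞 K))⁰) : Ideal (𝓞 K)) : FractionalIdeal (𝓞 K)⁰ K)),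
      ENNReal.ofReal ((|(Algebra.norm ℚ (a : K) : ℚ)| : ℝ) ^ (-σ)) ≠ ⊤ := by
  have h1 : ClassGroup.mk0 (1 : (Ideal (𝓞 K))⁰) = (1 : ClassGroup (𝓞 K))⁻¹ := by
    rw [map_one, inv_one]
  rw [tsum_conePoints_norm_rpow_eq 1 1 h1 σ]
  refine ENNReal.mul_ne_top (ENNReal.mul_ne_top (ENNReal.natCast_ne_top _) ENNReal.ofReal_ne_top) ?_
  -- the class sum of the principal class is finite
  have hs := summable_norm_classSum_term (K := K) 1 (s := (σ : ℂ)) (by simpa using hσ)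
  have hs' : Summable fun I : {I : (Ideal (𝓞 K))⁰ // ClassGroup.mk0 I = 1} ↦
      ((Ideal.absNorm (I.1 : Ideal (𝓞 K)) : ℝ) ^ (-σ)) := by
    refine hs.congr fun I ↦ ?_
    rw [Complex.norm_natCast_cpow_of_pos (Ideal.absNorm_pos_of_nonZeroDivisors I.1), Complex.neg_re,
      Complex.ofReal_re]
  rw [← ENNReal.ofReal_tsum_of_nonneg (fun I ↦ Real.rpow_nonneg (Nat.cast_nonneg _) _) hs']
  exact ENNReal.ofReal_ne_top

/-- **Convergence of the norm series over the representatives** (Neukirch VII (8.1) for the partial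
series `Σ_{a ∈ ℜ} |N(a)|^{-s}` of the proof of (8.3), here for one sign piece of a coset modulo
`V = ⟨u_i^N⟩`): for real `σ > 1`, `Σ_{x ∈ pieceReps K p ς 𝔞 a₀ N} |N(x)|^{-σ} < ∞` (`ℝ≥0∞`-valued).
Proof: with a common denominator `d ∈ ℕ` of `𝔞 + (a₀)`, `x ↦ (cone representative of dx, cone
exponent of dx = cone exponent of x)` is injective into `(cone points of 𝒪) × [0,N)^{r-1}`, and
`|N(x)|^{-σ} = d^{nσ} |N(dx)|^{-σ}`. [cite: NeukirchANT1999, Ch. VII §8 (8.1) and proof of (8.3)] -/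
theorem tsum_pieceReps_norm_rpow_ne_top (p : Finset {w : InfinitePlace K // IsReal w}) (ς : SignType)
    (I : FractionalIdeal (𝓞 K)⁰ K) (a₀ : K) (N : ℕ) {σ : ℝ} (hσ : 1 < σ) :
    ∑' x : pieceReps K p ς I a₀ N, ENNReal.ofReal ((|(Algebra.norm ℚ (x : K) : ℚ)| : ℝ) ^ (-σ)) ≠ ⊤ := by
  -- the fractional ideal `J = 𝔞 + (a₀)` containing the coset, and a common denominator
  set J := I ⊔ FractionalIdeal.spanSingleton (𝓞 K)⁰ a₀ with hJ
  have hmemJ : ∀ x : pieceReps K p ς I a₀ N, (x : K) ∈ J := fun x ↦ by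
    have h := add_mem_sup_spanSingleton I a₀ ⟨(x : K) - a₀, x.2.1⟩
    have h' : (((⟨(x : K) - a₀, x.2.1⟩ : I) : K)) + a₀ = (x : K) := sub_add_cancel _ _
    rw [h'] at h
    exact h
  obtain ⟨d, hd0, hd⟩ := exists_natCast_mul_mem_one J
  set F₁ : FractionalIdeal (𝓞 K)⁰ K := (((1 : (Ideal (𝓞 K))⁰) : Ideal (𝓞 K)) : FractionalIdeal (𝓞 K)⁰ K)
    with hF₁
  have hF₁1 : F₁ = 1 := coeIdeal_one_eq
  have hdx : ∀ x : pieceReps K p ς I a₀ N, (d : K) * (x : K) ∈ F₁ ∧ (d : K) * (x : K) ≠ 0 := fun x ↦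
    ⟨hF₁1 ▸ hd _ (hmemJ x), mul_ne_zero (Nat.cast_ne_zero.mpr hd0) (ne_zero_of_mem_pieceReps x.2)⟩
  -- the comparison map
  obtain ⟨Φ, hΦ⟩ : ∃ Φ : pieceReps K p ς I a₀ N → conePoints K F₁ × (Fin (rank K) → ℤ),
      Φ = fun x : pieceReps K p ς I a₀ N ↦ coneDecompEquiv K F₁ ⟨(d : K) * (x : K), hdx x⟩ := ⟨_, rfl⟩
  have hΦinj : Function.Injective Φ := by
    intro x x' h
    rw [hΦ] at h
    have h' := (coneDecompEquiv K F₁).injective h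
    have h'' : (d : K) * (x : K) = (d : K) * (x' : K) := congrArg Subtype.val h'
    exact Subtype.ext (mul_left_cancel₀ (Nat.cast_ne_zero.mpr hd0) h'')
  -- its second coordinate lies in the finite box `-[0,N)^{r-1}`
  set S : Finset (Fin (rank K) → ℤ) := Fintype.piFinset fun _ ↦ Finset.Ioc (-(N : ℤ)) 0 with hS
  have hΦ2 : ∀ x, (Φ x).2 ∈ S := by
    intro x
    have h2 : (Φ x).2 = -coneExponent ((d : K) * (x : K)) (hdx x).2 := by rw [hΦ]; rfl
    have h3 : coneExponent ((d : K) * (x : K)) (hdx x).2 = coneExp (x : K) := by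
      rw [← coneExp_of_ne_zero (hdx x).2, coneExp_natCast_mul hd0]
    rw [hS, Fintype.mem_piFinset]
    intro i
    rw [h2, Pi.neg_apply, h3, Finset.mem_Ioc]
    have := x.2.2.2 i
    rw [Set.mem_Ico] at this
    omega
  -- its first coordinate has the norm of `dx`
  have hΦ1 : ∀ x, (|(Algebra.norm ℚ (((Φ x).1 : K)) : ℚ)| : ℝ) =
      (|(Algebra.norm ℚ ((d : K) * (x : K)) : ℚ)| : ℝ) := fun x ↦ by
    rw [← Rat.cast_abs, ← Rat.cast_abs, hΦ]
    exact_mod_cast abs_norm_unit_mul _ _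
  -- rescaling `|N(x)|^{-σ} = d^{nσ} |N(dx)|^{-σ}`
  have hdpos : (0 : ℝ) < (d : ℝ) ^ Module.finrank ℚ K := pow_pos (Nat.cast_pos.mpr (Nat.pos_of_ne_zero hd0)) _
  have hresc : ∀ x : pieceReps K p ς I a₀ N,
      ENNReal.ofReal ((|(Algebra.norm ℚ (x : K) : ℚ)| : ℝ) ^ (-σ)) =
        ENNReal.ofReal (((d : ℝ) ^ Module.finrank ℚ K) ^ σ) *
          ENNReal.ofReal ((|(Algebra.norm ℚ ((d : K) * (x : K)) : ℚ)| : ℝ) ^ (-σ)) := by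
    intro x
    have hx0 : (x : K) ≠ 0 := ne_zero_of_mem_pieceReps x.2
    have hNx : (0 : ℝ) < (|(Algebra.norm ℚ (x : K) : ℚ)| : ℝ) := by
      rw [← Rat.cast_abs]; exact_mod_cast abs_pos.mpr (Algebra.norm_ne_zero_iff.mpr hx0)
    rw [← ENNReal.ofReal_mul (Real.rpow_nonneg hdpos.le _)]
    congr 1
    have : (|(Algebra.norm ℚ ((d : K) * (x : K)) : ℚ)| : ℝ) =
        (d : ℝ) ^ Module.finrank ℚ K * (|(Algebra.norm ℚ (x : K) : ℚ)| : ℝ) := by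
      rw [← Rat.cast_abs, ← Rat.cast_abs, abs_norm_natCast_mul]; push_cast; ring
    rw [this, Real.mul_rpow hdpos.le hNx.le, ← mul_assoc, ← Real.rpow_add hdpos, add_neg_cancel,
      Real.rpow_zero, one_mul]
  -- the dominating function on the target
  obtain ⟨g, hg⟩ : ∃ g : conePoints K F₁ × (Fin (rank K) → ℤ) → ℝ≥0∞, g = fun z ↦
      if z.2 ∈ S then ENNReal.ofReal ((|(Algebra.norm ℚ ((z.1 : K)) : ℚ)| : ℝ) ^ (-σ)) else 0 := ⟨_, rfl⟩
  have hgΦ : ∀ x : pieceReps K p ς I a₀ N,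
      ENNReal.ofReal ((|(Algebra.norm ℚ ((d : K) * (x : K)) : ℚ)| : ℝ) ^ (-σ)) = g (Φ x) := by
    intro x
    rw [hg]
    simp only
    rw [if_pos (hΦ2 x), hΦ1 x]
  -- the target series is finite
  have hgsum : ∑' z, g z ≠ ⊤ := by
    rw [ENNReal.tsum_prod']
    have hinner : ∀ c : conePoints K F₁, ∑' m : Fin (rank K) → ℤ, g (c, m) =
        (S.card : ℝ≥0∞) * ENNReal.ofReal ((|(Algebra.norm ℚ ((c : K)) : ℚ)| : ℝ) ^ (-σ)) := by
      intro c
      have hsupp : ∀ m ∉ S, g (c, m) = 0 := fun m hm ↦ by rw [hg]; exact if_neg hm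
      have hval : ∀ m ∈ S, g (c, m) = ENNReal.ofReal ((|(Algebra.norm ℚ ((c : K)) : ℚ)| : ℝ) ^ (-σ)) :=
        fun m hm ↦ by rw [hg]; exact if_pos hm
      rw [tsum_eq_sum hsupp, Finset.sum_congr rfl hval, Finset.sum_const, nsmul_eq_mul]
    simp_rw [hinner]
    rw [ENNReal.tsum_mul_left]
    exact ENNReal.mul_ne_top (ENNReal.natCast_ne_top _) (hF₁ ▸ tsum_conePoints_one_norm_rpow_ne_top hσ)
  -- compare
  simp_rw [hresc]
  rw [ENNReal.tsum_mul_left]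
  refine ENNReal.mul_ne_top ENNReal.ofReal_ne_top (ne_top_of_le_ne_top hgsum ?_)
  calc ∑' x : pieceReps K p ς I a₀ N, ENNReal.ofReal ((|(Algebra.norm ℚ ((d : K) * (x : K)) : ℚ)| : ℝ) ^ (-σ))
      = ∑' x, g (Φ x) := tsum_congr hgΦ
    _ ≤ ∑' z, g z := ENNReal.tsum_comp_le_tsum_of_injective hΦinj g

/-- Real form: `Σ_{x ∈ pieceReps} |N(x)|^{-σ}` is summable for `σ > 1`. [folklore] -/
theorem summable_pieceReps_norm_rpow (p : Finset {w : InfinitePlace K // IsReal w}) (ς : SignType)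
    (I : FractionalIdeal (𝓞 K)⁰ K) (a₀ : K) (N : ℕ) {σ : ℝ} (hσ : 1 < σ) :
    Summable fun x : pieceReps K p ς I a₀ N ↦ (|(Algebra.norm ℚ (x : K) : ℚ)| : ℝ) ^ (-σ) := by
  have h := ENNReal.summable_toReal (tsum_pieceReps_norm_rpow_ne_top p ς I a₀ N hσ)
  refine h.congr fun x ↦ ?_
  exact ENNReal.toReal_ofReal (Real.rpow_nonneg (abs_nonneg _) _)

/-! ## The Dirichlet series `D(s) = Σ_{x ∈ pieceReps} |N(x)|^{-s}` -/

variable (K) in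
/-- **The Dirichlet series over the representatives of a sign piece**:
`D^{p,ς}_{𝔞,a₀,N}(s) = Σ_{x ∈ pieceReps K p ς 𝔞 a₀ N} |N_{K/ℚ}(x)|^{-s}` — one sign piece of Neukirch's
partial series `Σ_{a ∈ ℜ} χ((a))/|N(a)|^s = L(𝔎, χ, s)` (VII §8, before (8.2)), modulo `V = ⟨u_i^N⟩`
instead of `𝒪^*`; an unconditional sum (the genuine value for `re s > 1`). [cite: NeukirchANT1999, Ch. VII §8, before (8.2)] -/
def pieceDirichlet (p : Finset {w : InfinitePlace K // IsReal w}) (ς : SignType)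
    (I : FractionalIdeal (𝓞 K)⁰ K) (a₀ : K) (N : ℕ) (s : ℂ) : ℂ :=
  ∑' x : pieceReps K p ς I a₀ N, (((|(Algebra.norm ℚ (x : K) : ℚ)| : ℝ)) : ℂ) ^ (-s)

/-- The norm of a representative is a positive real number. [folklore] -/
theorem abs_norm_pos_of_mem_pieceReps {p : Finset {w : InfinitePlace K // IsReal w}} {ς : SignType}
    {I : FractionalIdeal (𝓞 K)⁰ K} {a₀ : K} {N : ℕ} (x : pieceReps K p ς I a₀ N) :
    (0 : ℝ) < (|(Algebra.norm ℚ (x : K) : ℚ)| : ℝ) := by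
  rw [← Rat.cast_abs]
  exact_mod_cast abs_pos.mpr (Algebra.norm_ne_zero_iff.mpr (ne_zero_of_mem_pieceReps x.2))

/-- **Absolute convergence of `D(s)` for `re s > 1`** (Neukirch VII (8.1)). [cite: NeukirchANT1999, Ch. VII §8 (8.1) Proposition] -/
theorem summable_norm_pieceDirichlet_term (p : Finset {w : InfinitePlace K // IsReal w}) (ς : SignType)
    (I : FractionalIdeal (𝓞 K)⁰ K) (a₀ : K) (N : ℕ) {s : ℂ} (hs : 1 < s.re) :
    Summable fun x : pieceReps K p ς I a₀ N ↦ ‖(((|(Algebra.norm ℚ (x : K) : ℚ)| : ℝ)) : ℂ) ^ (-s)‖ := by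
  refine (summable_pieceReps_norm_rpow p ς I a₀ N hs).congr fun x ↦ ?_
  rw [Complex.norm_cpow_eq_rpow_re_of_pos (abs_norm_pos_of_mem_pieceReps x), Complex.neg_re]

/-- **`D(s)` is holomorphic on `re s > 1`** (locally uniform convergence, Mathlib
`differentiableOn_tsum_of_summable_norm`). [folklore] -/
theorem differentiableOn_pieceDirichlet (p : Finset {w : InfinitePlace K // IsReal w}) (ς : SignType)
    (I : FractionalIdeal (𝓞 K)⁰ K) (a₀ : K) (N : ℕ) :
    DifferentiableOn ℂ (pieceDirichlet K p ς I a₀ N) {s | 1 < s.re} := by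
  intro s hs
  obtain ⟨δ, hδ, hδs⟩ : ∃ δ : ℝ, 0 < δ ∧ 1 + δ < s.re :=
    ⟨(s.re - 1) / 2, by simp only [Set.mem_setOf_eq] at hs; linarith,
      by simp only [Set.mem_setOf_eq] at hs; linarith⟩
  -- a bounded vertical strip around `s` (the norms `|N(x)|` may be `< 1` on a coset)
  set U : Set ℂ := {z : ℂ | 1 + δ < z.re ∧ z.re < s.re + 1} with hU
  have hopen : IsOpen U :=
    (isOpen_lt continuous_const Complex.continuous_re).inter (isOpen_lt Complex.continuous_re continuous_const)
  have hsU : U ∈ 𝓝 s := hopen.mem_nhds ⟨hδs, by simp⟩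
  suffices h : DifferentiableOn ℂ (pieceDirichlet K p ς I a₀ N) U from
    (h.differentiableAt hsU).differentiableWithinAt
  have hsum1 := summable_pieceReps_norm_rpow p ς I a₀ N (σ := 1 + δ) (by linarith)
  have hsum2 := summable_pieceReps_norm_rpow p ς I a₀ N (σ := s.re + 1)
    (by simp only [Set.mem_setOf_eq] at hs; linarith)
  have heq : pieceDirichlet K p ς I a₀ N = fun z ↦
      ∑' x : pieceReps K p ς I a₀ N, (((|(Algebra.norm ℚ (x : K) : ℚ)| : ℝ)) : ℂ) ^ (-z) := rfl
  rw [heq]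
  refine Complex.differentiableOn_tsum_of_summable_norm (hsum1.add hsum2) (fun x ↦ ?_) hopen
    (fun x z hz ↦ ?_)
  · intro z _
    refine DifferentiableAt.differentiableWithinAt ?_
    refine DifferentiableAt.const_cpow differentiableAt_id.neg (Or.inl ?_)
    exact_mod_cast (abs_norm_pos_of_mem_pieceReps x).ne'
  · have hN := abs_norm_pos_of_mem_pieceReps x
    have hz1 : 1 + δ < z.re := hz.1
    have hz2 : z.re < s.re + 1 := hz.2
    rw [Complex.norm_cpow_eq_rpow_re_of_pos hN, Complex.neg_re]
    set b : ℝ := (|(Algebra.norm ℚ (x : K) : ℚ)| : ℝ) with hb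
    have h1 : 0 ≤ b ^ (-(1 + δ)) := Real.rpow_nonneg hN.le _
    have h2 : 0 ≤ b ^ (-(s.re + 1)) := Real.rpow_nonneg hN.le _
    show b ^ (-z.re) ≤ b ^ (-(1 + δ)) + b ^ (-(s.re + 1))
    rcases le_or_gt 1 b with hb1 | hb1
    · have : b ^ (-z.re) ≤ b ^ (-(1 + δ)) := Real.rpow_le_rpow_of_exponent_le hb1 (by linarith)
      linarith
    · have : b ^ (-z.re) ≤ b ^ (-(s.re + 1)) :=
        Real.rpow_le_rpow_of_exponent_ge hN hb1.le (by linarith)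
      linarith

/-- **`D` at a real point is the real series computed in `ℝ≥0∞`** (the right-hand side of
`lintegral_Ioi_rpow_mul_lintegral_unitCube_pieceTheta`; both sides carry the same junk value `0`
when the series diverges). [folklore] -/
theorem pieceDirichlet_ofReal (p : Finset {w : InfinitePlace K // IsReal w}) (ς : SignType)
    (I : FractionalIdeal (𝓞 K)⁰ K) (a₀ : K) (N : ℕ) (x : ℝ) :
    pieceDirichlet K p ς I a₀ N x =
      (((∑' z : pieceReps K p ς I a₀ N,
        ENNReal.ofReal ((|(Algebra.norm ℚ (z : K) : ℚ)| : ℝ) ^ (-x))).toReal : ℝ) : ℂ) := by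
  have hterm : ∀ z : pieceReps K p ς I a₀ N,
      (((|(Algebra.norm ℚ (z : K) : ℚ)| : ℝ)) : ℂ) ^ (-(x : ℂ)) =
        ((((|(Algebra.norm ℚ (z : K) : ℚ)| : ℝ)) ^ (-x) : ℝ) : ℂ) := by
    intro z
    rw [Complex.ofReal_cpow (abs_nonneg _), Complex.ofReal_neg]
  unfold pieceDirichlet
  simp_rw [hterm]
  rw [← Complex.ofReal_tsum]
  congr 1
  rw [ENNReal.tsum_toReal_eq (fun _ ↦ ENNReal.ofReal_ne_top)]
  refine tsum_congr fun z ↦ ?_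
  rw [ENNReal.toReal_ofReal (Real.rpow_nonneg (abs_nonneg _) _)]

end NumberField

end Literature.NumberTheory.LFunctions
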